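import Mathlib
import Summits.ValiantsHypothesis.ValiantsHypothesis.Theorems.KPlusLogSqLawWeakLiftingTowerGraftClusterDiscs

/-!
# Tower graft line — NEAR-FIELD LOCALISATION (the coverage half of the sharp T1 interface)

Mechanism file for the line `Cruxes/WeakLifting/Lines/tower_graft.lean` (crux `WeakLifting` = stmt-ValiantsHypothesis-19561, T1 «log-slope
localisation»); companion of `…TowerGraftClusterDiscs.lean`.  NO stub is claimed.
The sharp T1 interface `card_posRoots_add_X_pow_mul_le_of_rouche_discs` asks the consumer for two things per disc system: the Rouché
inequality on each circle (`rouche_ineq_of_rootSum_norm_lt`: a ROOT-SUM bound `‖Σ_A τ/(τ−z) − Σ_E τ/(τ−z)‖ < D`) and COVERAGE of the positive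
zeros of the residual `W` off `A·E = 0`.  This file supplies the matching coverage tool at ANY scale `δ`
(`exists_root_near_of_residual_zero_of_farField`): if at a positive zero `t` of `W` off the roots the FAR FIELD is small —
`Σ_{roots z of A·E with ‖t − z‖ > δ·t} ‖t/(t − z)‖ ≤ D/2` — then some root of `A·E` lies within `δ·t` of `t`.  (The crude instance
`δ = 2n/D` with the far field bounded termwise is `exists_inSector_root_near_of_residual_zero` of `…EventLocalisation.lean`; at wavelength
scale `δ ≈ c/D` the far-field bound is the consumer's — e.g. `≈ N·log N` for a `2π/N`-spaced cloud, memo T1-CORNER §6.)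
HONEST FRAMING: elementary; nothing on S4/S4b/S5, TowerB, `WeakLifting`, B, 18050 or `VP ≠ VNP`.  Def-free.
Seat: prover val-sym-lift-p1 g20, `--supports stmt-ValiantsHypothesis-19561`.
-/

-- `Summit.ValiantsHypothesis.ValiantsHypothesis.…` repeats a component by the D-0017 layout
-- (single-conjunct summit), which the `dupNamespace` linter flags; the name is mandated.
set_option linter.dupNamespace false

namespace Summit.ValiantsHypothesis.ValiantsHypothesis.Theorems.KPlusLogSqLaw.TowerGraft

open Polynomial Complex
open scoped BigOperators Polynomial Real

section NearField

/-- **NEAR-FIELD LOCALISATION.**  `A, E ∈ ℝ[X]`, `t` real with `A(t)E(t) ≠ 0` a zero of the residual `X(A′E − AE′) − D·AE`, `δ > 0`.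
If the far field `Σ_{‖t − z‖ > δt} ‖t/(t − z)‖` over the complex roots of `A·E` is `≤ D/2` and `D > 0`, then some complex root `z` of
`A·E` has `‖t − z‖ ≤ δ·t`. [this work] -/
theorem exists_root_near_of_residual_zero_of_farField (A E : ℝ[X]) {D : ℕ} (hD : 0 < D) {t δ : ℝ}
    (hAt : A.eval t ≠ 0) (hEt : E.eval t ≠ 0)
    (hW : (X * (derivative A * E - A * derivative E) - C (D : ℝ) * (A * E)).eval t = 0)
    (hfar : ((((A.map Complex.ofRealHom).roots + (E.map Complex.ofRealHom).roots).filter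
        (fun z => δ * t < ‖(t : ℂ) - z‖)).map (fun z => ‖(t : ℂ) / ((t : ℂ) - z)‖)).sum ≤ (D : ℝ) / 2) :
    ∃ z ∈ (A.map Complex.ofRealHom).roots + (E.map Complex.ofRealHom).roots, ‖(t : ℂ) - z‖ ≤ δ * t := by
  classical
  set Z := (A.map Complex.ofRealHom).roots + (E.map Complex.ofRealHom).roots with hZ
  -- the potential vanishes and `D ≤ Σ_Z ‖t/(t−z)‖`
  have hΦ : t * (A.derivative.eval t / A.eval t) - D - t * (E.derivative.eval t / E.eval t) = 0 := by
    have h0 := residual_eval_eq A E D hAt hEt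
    rw [hW] at h0
    rcases mul_eq_zero.mp h0.symm with h1 | h1
    · exact absurd h1 (mul_ne_zero hAt hEt)
    · exact h1
  rw [mul_logDeriv_eq_rootSum_re A hAt, mul_logDeriv_eq_rootSum_re E hEt] at hΦ
  have hDle : (D : ℝ) ≤ (Z.map fun z => ‖(t : ℂ) / ((t : ℂ) - z)‖).sum := by
    have h1 := abs_rootSum_re_le_sum_norm (A.map Complex.ofRealHom).roots t
    have h2 := abs_rootSum_re_le_sum_norm (E.map Complex.ofRealHom).roots t
    have e1 := le_abs_self ((((A.map Complex.ofRealHom).roots.map fun z => (t : ℂ) / ((t : ℂ) - z)).sum).re)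
    have e2 := neg_abs_le ((((E.map Complex.ofRealHom).roots.map fun z => (t : ℂ) / ((t : ℂ) - z)).sum).re)
    rw [hZ, Multiset.map_add, Multiset.sum_add]
    linarith
  -- split into far and near
  have hsplit : (Z.map fun z => ‖(t : ℂ) / ((t : ℂ) - z)‖).sum =
      ((Z.filter fun z => δ * t < ‖(t : ℂ) - z‖).map fun z => ‖(t : ℂ) / ((t : ℂ) - z)‖).sum +
      ((Z.filter fun z => ¬ δ * t < ‖(t : ℂ) - z‖).map fun z => ‖(t : ℂ) / ((t : ℂ) - z)‖).sum := by
    rw [← Multiset.sum_add, ← Multiset.map_add, Multiset.filter_add_not]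
  have hD0 : (0 : ℝ) < D := by exact_mod_cast hD
  have hnear_pos : 0 < ((Z.filter fun z => ¬ δ * t < ‖(t : ℂ) - z‖).map fun z => ‖(t : ℂ) / ((t : ℂ) - z)‖).sum := by
    linarith
  -- a positive sum over a multiset has a member
  have hne : (Z.filter fun z => ¬ δ * t < ‖(t : ℂ) - z‖) ≠ 0 := by
    intro h0
    rw [h0, Multiset.map_zero, Multiset.sum_zero] at hnear_pos
    exact lt_irrefl _ hnear_pos
  obtain ⟨z, hz⟩ := Multiset.exists_mem_of_ne_zero hne
  rw [Multiset.mem_filter] at hz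
  exact ⟨z, hz.1, not_lt.mp hz.2⟩

end NearField

end Summit.ValiantsHypothesis.ValiantsHypothesis.Theorems.KPlusLogSqLaw.TowerGraft
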